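import Summits.PneNP.PneNP.Theorems.PstarSA2Blind
import Summits.PneNP.PneNP.Theorems.PstarSALevel

/-!
# Sherali–Adams laws for typed `P⋆` fibres, I: the local factors and the peeling identity (cell `pnp-ideate`, T21.1a)

FRONTIER range-avoidance ladder, rung F-N3 context — restricted-model lower-bound bookkeeping for the Sherali–Adams
hierarchy (`PstarSALevel.SAFeasible`); nothing here bears on `P` vs `NP`.

Benabbas–Georgiou–Magen–Tulsiani (*SDP gaps from pairwise independence*, Theory Comput. 8 (2012), §3.2) build locally
consistent laws `P_µ(S) ∝ ∏_{C ⊆ S} µ(α|C)` from a BALANCED pairwise independent distribution `µ` supported on the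
predicate, and prove consistency by PEELING constraints with `≥ k − 2` private variables (Lemma 3.2 / Claim 3.3).  For a
TYPED pure-`P⋆` instance and an arbitrary target `y` the supporting laws are `PstarPairwise.lp (√2/2) (y j)` — pairwise
independent with TYPE-CONSISTENT slot biases (`½` on XOR slots, `r = √2/2` on AND slots) instead of balanced — and balance
is replaced by the junction-tree reweighting with the variable biases `bias I v` (cell memo `r20/ROUND-20-SEED.md` §8).
This file is the local calculus that makes the peeling go through in the biased setting:

* `bias`, `mu` (the local factor `lp r (y j)` read through `vars j`), cylinders `cylOff F x` (assignments equal to `x`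
  off `F`) and the product rule `sum_cylOff_prod`;
* slot marginals of `lp` with at most two slots fixed are PRODUCTS of slot biases (`sum_fix_lp`, from
  `PstarPairwise.pairwiseIndep_lp` / `pr1_lp_*` / `lp_total`), transported to variables along the injective `vars j`
  (`sum_cylOff_comp`);
* **the peeling identity** `sum_cylOff_mu`: summing the local factor of output `j₀` over `≥ 2` of its variables leaves the
  product of the TYPE BIASES of its remaining (`≤ 2`) variables — typedness is exactly the consistency of the two biases
  (`PstarSA2Blind.not_isXorVar_of_typed`).

Part II (`PstarSAPeelStep`) peels one constraint of the reweighted product; part III (`PstarSAConsistency`) proves the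
analogue of BGMT Lemma 3.2: normalisation and consistency of the laws under boundary expansion.
-/

set_option linter.dupNamespace false

open Finset Literature.Computability.Complexity
open Summit.PneNP.PneNP.Theorems.PstarPairwise
open Summit.PneNP.PneNP.Theorems.PstarSA2Blind (IsXorVar not_isXorVar_of_typed)
open Summit.PneNP.PneNP.Theorems.PstarSALevel (varSet)

namespace Summit.PneNP.PneNP.Theorems.PstarSAPeeling

variable {n m : ℕ}

/-! ## The AND bias `r = √2/2` -/

/-- The AND-variable bias `r = √2/2 = 1/√2` (`2r² = 1`). -/
noncomputable def rA : ℝ := Real.sqrt 2 / 2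

/-- `2r² = 1`. -/
theorem two_mul_rA_sq : 2 * rA ^ 2 = 1 := lp_hyp_sqrt.1

/-- `0 < r`. -/
theorem rA_pos : 0 < rA := by
  unfold rA
  exact div_pos (Real.sqrt_pos.2 (by norm_num)) (by norm_num)

/-- `r < 1`. -/
theorem rA_lt_one : rA < 1 := by
  unfold rA
  rw [div_lt_one (by norm_num : (0 : ℝ) < 2)]
  exact (Real.sqrt_lt' (by norm_num)).2 (by norm_num)

/-! ## Biases, local factors -/

open Classical in
/-- The TYPE BIAS of a variable: `½` if it occurs in an XOR slot, `r` otherwise. -/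
noncomputable def bias (I : LocalMap 4 n m) (v : Fin n) : ℝ := if IsXorVar I v then 1 / 2 else rA

/-- Both values of a biased bit have positive weight. -/
theorem rho_bias_pos (I : LocalMap 4 n m) (v : Fin n) (b : Bool) : 0 < rho (bias I v) b := by
  have h1 := rA_pos
  have h2 := rA_lt_one
  unfold bias rho
  split_ifs <;> linarith

/-- The two weights of a biased bit sum to `1`. -/
theorem rho_add (p : ℝ) : rho p true + rho p false = 1 := by
  simp [rho]

/-- The two weights of a biased bit sum to `1` (as a sum over `Bool`). -/
theorem sum_rho (p : ℝ) : ∑ b : Bool, rho p b = 1 := by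
  rw [Fintype.sum_bool, rho_add]

/-- The LOCAL FACTOR of output `j` for the target `y`: the law `lp r (y j)` on slot patterns, read through the
positions `vars j` at a full assignment. -/
noncomputable def mu (I : LocalMap 4 n m) (y : Fin m → Bool) (j : Fin m) (x : Fin n → Bool) : ℝ :=
  lp rA (y j) (fun s => x (I.vars j s))

/-- Local factors are nonnegative. -/
theorem mu_nonneg (I : LocalMap 4 n m) (y : Fin m → Bool) (j : Fin m) (x : Fin n → Bool) : 0 ≤ mu I y j x :=
  lp_nonneg rA_pos.le rA_lt_one.le _ _

/-- The local factor of `j` only reads the variables of `j`. -/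
theorem mu_congr (I : LocalMap 4 n m) (y : Fin m → Bool) (j : Fin m) {β x : Fin n → Bool}
    (h : ∀ v ∈ varSet I j, β v = x v) : mu I y j β = mu I y j x := by
  unfold mu
  have e : (fun s => β (I.vars j s)) = fun s => x (I.vars j s) :=
    funext fun s => h _ (mem_image_of_mem _ (mem_univ _))
  rw [e]

/-- **Support**: where the local factor of `j` is nonzero, output `j` of a pure `P⋆` instance takes the value `y j`. -/
theorem eval_eq_of_mu_ne_zero {I : LocalMap 4 n m} (hI : I.IsPure xorAndPred) {y : Fin m → Bool} {j : Fin m}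
    {x : Fin n → Bool} (h : mu I y j x ≠ 0) : I.eval x j = y j := by
  have hs := lp_support rA (y j) _ h
  show I.table j (fun s => x (I.vars j s)) = y j
  rw [hI.1 j]
  exact hs

/-! ## Cylinders -/

/-- The assignments that agree with `x` OFF the set `F` (free on `F`). -/
def cylOff (F : Finset (Fin n)) (x : Fin n → Bool) : Finset (Fin n → Bool) :=
  univ.filter fun β => ∀ v, v ∉ F → β v = x v

/-- Membership in a cylinder. -/
theorem mem_cylOff {F : Finset (Fin n)} {x β : Fin n → Bool} : β ∈ cylOff F x ↔ ∀ v, v ∉ F → β v = x v := by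
  simp [cylOff]

/-- A cylinder contains its centre. -/
theorem self_mem_cylOff (F : Finset (Fin n)) (x : Fin n → Bool) : x ∈ cylOff F x :=
  mem_cylOff.2 fun _ _ => rfl

/-- A cylinder is a product set. -/
theorem cylOff_eq_piFinset (F : Finset (Fin n)) (x : Fin n → Bool) :
    cylOff F x = Fintype.piFinset fun v => if v ∈ F then (univ : Finset Bool) else {x v} := by
  ext β
  rw [mem_cylOff, Fintype.mem_piFinset]
  constructor
  · intro h v
    by_cases hv : v ∈ F
    · simp [hv]
    · simp [hv, h v hv]
  · intro h v hv
    have h' := h v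
    rw [if_neg hv, mem_singleton] at h'
    exact h'

/-- **Product rule**: summing a product of one-variable functions over a cylinder. -/
theorem sum_cylOff_prod (F : Finset (Fin n)) (x : Fin n → Bool) (g : Fin n → Bool → ℝ) :
    ∑ β ∈ cylOff F x, ∏ v ∈ F, g v (β v) = ∏ v ∈ F, ∑ b, g v b := by
  classical
  have h := Finset.prod_univ_sum (fun v => if v ∈ F then (univ : Finset Bool) else {x v})
    (fun v b => if v ∈ F then g v b else 1)
  rw [← cylOff_eq_piFinset] at h
  have h1 : ∀ β : Fin n → Bool, (∏ v, if v ∈ F then g v (β v) else 1) = ∏ v ∈ F, g v (β v) := fun β => by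
    rw [prod_ite_mem, univ_inter]
  have h2 : (∏ v, ∑ b ∈ (if v ∈ F then (univ : Finset Bool) else {x v}), if v ∈ F then g v b else 1) =
      ∏ v ∈ F, ∑ b, g v b := by
    have h3 : ∀ v : Fin n, (∑ b ∈ (if v ∈ F then (univ : Finset Bool) else {x v}), if v ∈ F then g v b else 1) =
        if v ∈ F then ∑ b, g v b else 1 := fun v => by
      split_ifs with hv
      · rfl
      · rw [sum_singleton]
    rw [prod_congr rfl fun v _ => h3 v, prod_ite_mem, univ_inter]
  rw [h2] at h
  rw [h]
  exact sum_congr rfl fun β _ => (h1 β).symm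

/-- Summing the product of the biases of the free variables over a cylinder gives `1`. -/
theorem sum_cylOff_prod_rho (I : LocalMap 4 n m) (F : Finset (Fin n)) (x : Fin n → Bool) :
    ∑ β ∈ cylOff F x, ∏ v ∈ F, rho (bias I v) (β v) = 1 := by
  rw [sum_cylOff_prod F x fun v b => rho (bias I v) b]
  exact prod_eq_one fun v _ => sum_rho _

/-! ## Slot marginals of `lp` with at most two slots fixed -/

/-- The SLOT BIAS of slot `s`: `½` on the XOR slots `0, 1`, `ρ_r` on the AND slots `2, 3`. -/
noncomputable def sb (s : Fin 4) (b : Bool) : ℝ := if s.val < 2 then 1 / 2 else rho rA b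

/-- The two one-slot marginals add up to the total mass. -/
theorem pr1_add (w : (Fin 4 → Bool) → ℝ) (i : Fin 4) : pr1 w i true + pr1 w i false = ∑ u, w u := by
  unfold pr1
  rw [← sum_add_distrib]
  refine sum_congr rfl fun u _ => ?_
  cases u i <;> simp

/-- One-slot marginals of `lp r s` at `true` are the slot biases. -/
theorem pr1_lp_true (s : Bool) (i : Fin 4) : pr1 (lp rA s) i true = sb i true := by
  have e0 : pr1 (lp rA s) 0 true = sb 0 true := by rw [pr1_lp_zero]; simp [sb]
  have e1 : pr1 (lp rA s) 1 true = sb 1 true := by rw [pr1_lp_one]; simp [sb]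
  have e2 : pr1 (lp rA s) 2 true = sb 2 true := by rw [pr1_lp_two]; simp [sb, rho]
  have e3 : pr1 (lp rA s) 3 true = sb 3 true := by rw [pr1_lp_three]; simp [sb, rho]
  fin_cases i
  exacts [e0, e1, e2, e3]

/-- One-slot marginals of `lp r s` are the slot biases (both values). -/
theorem pr1_lp_eq (s : Bool) (i : Fin 4) (b : Bool) : pr1 (lp rA s) i b = sb i b := by
  cases b
  · have h := pr1_add (lp rA s) i
    rw [lp_total, pr1_lp_true] at h
    have h' : pr1 (lp rA s) i false = 1 - sb i true := by linarith
    rw [h']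
    unfold sb
    split_ifs
    · norm_num
    · simp [rho]
  · exact pr1_lp_true s i

/-- **Slot marginals are products**: fixing the values of at most two slots `Q`, the mass of `lp r s` on the
compatible patterns is the product of the slot biases of the fixed values (pairwise independence of `lp`). -/
theorem sum_fix_lp (s : Bool) (Q : Finset (Fin 4)) (hQ : Q.card ≤ 2) (u₀ : Fin 4 → Bool) :
    ∑ u ∈ univ.filter (fun u : Fin 4 → Bool => ∀ i ∈ Q, u i = u₀ i), lp rA s u = ∏ i ∈ Q, sb i (u₀ i) := by
  rcases Nat.lt_or_ge Q.card 1 with h | h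
  · have hQ0 : Q = ∅ := Finset.card_eq_zero.1 (show Q.card = 0 by omega)
    subst hQ0
    rw [prod_empty]
    have e : univ.filter (fun u : Fin 4 → Bool => ∀ i ∈ (∅ : Finset (Fin 4)), u i = u₀ i) = univ :=
      filter_true_of_mem fun u _ => by simp
    rw [e]
    exact lp_total rA s
  rcases Nat.lt_or_ge Q.card 2 with h2 | h2
  · obtain ⟨i, rfl⟩ := Finset.card_eq_one.1 (show Q.card = 1 by omega)
    rw [prod_singleton, ← pr1_lp_eq s, pr1, sum_filter]
    refine sum_congr rfl fun u _ => ?_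
    simp only [mem_singleton, forall_eq]
  · obtain ⟨i, j, hij, rfl⟩ := Finset.card_eq_two.1 (show Q.card = 2 by omega)
    rw [prod_pair hij, ← pr1_lp_eq s, ← pr1_lp_eq s, ← pairwiseIndep_lp two_mul_rA_sq s i j hij, pr2, sum_filter]
    refine sum_congr rfl fun u _ => ?_
    simp only [mem_insert, mem_singleton, forall_eq_or_imp, forall_eq]

/-! ## Transport along the positions of one output -/

/-- **Transport**: a cylinder sum of a function of the slot pattern of `e` (free set `F` inside the image of the
injective `e`) is the slot-pattern sum with the slots outside `F` fixed. -/
theorem sum_cylOff_comp {e : Fin 4 → Fin n} (he : Function.Injective e) {F : Finset (Fin n)} (hF : F ⊆ univ.image e)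
    (x : Fin n → Bool) (f : (Fin 4 → Bool) → ℝ) :
    ∑ β ∈ cylOff F x, f (fun s => β (e s)) =
      ∑ u ∈ univ.filter (fun u : Fin 4 → Bool => ∀ s ∈ univ.filter (fun s => e s ∉ F), u s = x (e s)), f u := by
  classical
  have hsl : ∀ {v}, v ∈ F → ∃ s, e s = v := fun hv => by
    obtain ⟨s, -, hs⟩ := mem_image.1 (hF hv)
    exact ⟨s, hs⟩
  let ψ : (Fin 4 → Bool) → (Fin n → Bool) := fun u v => if hv : v ∈ F then u (hsl hv).choose else x v
  refine Finset.sum_nbij' (fun β s => β (e s)) ψ ?_ ?_ ?_ ?_ (fun _ _ => rfl)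
  · intro β hβ
    rw [mem_cylOff] at hβ
    simp only [mem_filter, mem_univ, true_and]
    intro s hs
    exact hβ _ hs
  · intro u _
    rw [mem_cylOff]
    intro v hv
    simp only [ψ, dif_neg hv]
  · intro β hβ
    rw [mem_cylOff] at hβ
    funext v
    simp only [ψ]
    split_ifs with hv
    · rw [(hsl hv).choose_spec]
    · exact (hβ v hv).symm
  · intro u hu
    simp only [mem_filter, mem_univ, true_and] at hu
    funext s
    simp only [ψ]
    split_ifs with hv
    · exact congrArg u (he (hsl hv).choose_spec)
    · exact (hu s hv).symm

/-- The slots of `j₀` reading a variable of `F ⊆ varSet j₀` are as many as `F`. -/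
theorem card_slots_mem {I : LocalMap 4 n m} {j₀ : Fin m} (hinj : Function.Injective (I.vars j₀)) {F : Finset (Fin n)}
    (hF : F ⊆ varSet I j₀) : (univ.filter fun s => I.vars j₀ s ∈ F).card = F.card := by
  have himg : (univ.filter fun s => I.vars j₀ s ∈ F).image (I.vars j₀) = F := by
    ext v
    simp only [mem_image, mem_filter, mem_univ, true_and]
    constructor
    · rintro ⟨s, hs, rfl⟩; exact hs
    · intro hv
      obtain ⟨s, -, hs⟩ := mem_image.1 (hF hv)
      exact ⟨s, by rw [hs]; exact hv, hs⟩
  calc (univ.filter fun s => I.vars j₀ s ∈ F).card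
      = ((univ.filter fun s => I.vars j₀ s ∈ F).image (I.vars j₀)).card := (card_image_of_injective _ hinj).symm
    _ = F.card := by rw [himg]

/-- Hence the slots of `j₀` NOT reading into `F` number `4 − #F`. -/
theorem card_slots_not_mem {I : LocalMap 4 n m} {j₀ : Fin m} (hinj : Function.Injective (I.vars j₀))
    {F : Finset (Fin n)} (hF : F ⊆ varSet I j₀) : (univ.filter fun s => I.vars j₀ s ∉ F).card = 4 - F.card := by
  have h := Finset.card_filter_add_card_filter_not (s := (univ : Finset (Fin 4))) (fun s => I.vars j₀ s ∈ F)
  rw [card_slots_mem hinj hF, card_univ, Fintype.card_fin] at h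
  omega

/-- The variables read by the slots not reading into `F` are `varSet j₀ \ F`. -/
theorem image_slots_not_mem (I : LocalMap 4 n m) (j₀ : Fin m) (F : Finset (Fin n)) :
    (univ.filter fun s => I.vars j₀ s ∉ F).image (I.vars j₀) = varSet I j₀ \ F := by
  ext v
  simp only [mem_image, mem_filter, mem_univ, true_and, mem_sdiff, varSet]
  constructor
  · rintro ⟨s, hs, rfl⟩
    exact ⟨⟨s, rfl⟩, hs⟩
  · rintro ⟨⟨s, rfl⟩, hv⟩
    exact ⟨s, hv, rfl⟩

/-- **Typedness = bias consistency**: on a typed instance the slot bias of slot `s` of any output is the type bias of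
the variable read there. -/
theorem sb_eq_rho_bias {I : LocalMap 4 n m} (hT : PstarTyped.Typed I) (j₀ : Fin m) (s : Fin 4) (b : Bool) :
    sb s b = rho (bias I (I.vars j₀ s)) b := by
  unfold sb bias
  by_cases hs : s.val < 2
  · have hx : IsXorVar I (I.vars j₀ s) := ⟨j₀, s, hs, rfl⟩
    rw [if_pos hs, if_pos hx]
    cases b <;> norm_num [rho]
  · have hx : ¬ IsXorVar I (I.vars j₀ s) := not_isXorVar_of_typed I hT j₀ s (by omega)
    rw [if_neg hs, if_neg hx]

/-- **THE PEELING IDENTITY.**  On a typed pure `P⋆` instance, summing the local factor of output `j₀` over a cylinder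
free on `≥ 2` of its own variables leaves the product of the type biases of its remaining variables. -/
theorem sum_cylOff_mu {I : LocalMap 4 n m} (hI : I.IsPure xorAndPred) (hT : PstarTyped.Typed I) (y : Fin m → Bool)
    (j₀ : Fin m) {F : Finset (Fin n)} (hF : F ⊆ varSet I j₀) (h2 : 2 ≤ F.card) (x : Fin n → Bool) :
    ∑ β ∈ cylOff F x, mu I y j₀ β = ∏ v ∈ varSet I j₀ \ F, rho (bias I v) (x v) := by
  have hinj := hI.2 j₀
  have hQ : (univ.filter fun s => I.vars j₀ s ∉ F).card ≤ 2 := by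
    rw [card_slots_not_mem hinj hF]
    omega
  unfold mu
  rw [sum_cylOff_comp hinj hF x (lp rA (y j₀))]
  refine (sum_fix_lp (y j₀) _ hQ (fun s => x (I.vars j₀ s))).trans ?_
  rw [← image_slots_not_mem I j₀ F, prod_image fun s _ t _ h => hinj h]
  exact prod_congr rfl fun s _ => sb_eq_rho_bias hT j₀ s _

end Summit.PneNP.PneNP.Theorems.PstarSAPeeling
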